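import Literature.GroupTheory.CombinatorialGroupTheory.AmalgamReducedWords
import HarnessLib

/-!
# Cyclically reduced elements of an amalgam and the three impossible conjugations

Topic `Literature/GroupTheory/CombinatorialGroupTheory`; theorems only, continuing
`AmalgamReducedWords.lean` (letter lists `l : List (Σ i, G i)` in Mathlib's `Monoid.PushoutI φ`;
reduced = alternating factors, no letter in the amalgamated subgroup; value `ℓπ[φ] l`).
Call an element `y` *cyclically reduced* when no reduced word of length `≥ 2` with value `y` has
both end letters in the same factor; we spell this out as the hypothesis
`∀ L, (reduced L) → ℓπ L = y → 2 ≤ L.length → L.head?.map Sigma.fst ≠ L.getLast?.map Sigma.fst`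
(no definition is introduced).  This file is the bookkeeping half of the conjugation theorem for
amalgams (Magnus–Karrass–Solitar, *Combinatorial Group Theory*, §4.2, Thm. 4.6; Lyndon–Schupp
IV.2.8):

* `cr_of_word` — by uniqueness of the syllable pattern, the value of a reduced word of length
  `≤ 1`, or one whose end letters lie in different factors, is cyclically reduced;
  `cr_base_conj` — conjugating by the base group preserves cyclic reducedness;
* `not_cr_conj_of_ne_ne`, `not_cr_conj_of_last`, `not_cr_conj_of_head` — if `w` is a cyclically
  reduced word and the last letter `x` of a reduced word `h` lies in neither end factor of `w`,
  resp. lies in the factor of the last letter `γ` of `w` with `γ x⁻¹ ∉ H`, resp. in the factor of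
  the first letter `γ₀` with `x γ₀ ∉ H`, then `h · ℓπ w · h⁻¹` is NOT cyclically reduced: the
  evident word for it is reduced with both ends in the factor of the first letter of `h`.

## References

* W. Magnus, A. Karrass, D. Solitar, *Combinatorial Group Theory*, Interscience (1966), §4.2,
  Thm. 4.6. [MagnusKarrassSolitar1966]
* R. C. Lyndon, P. E. Schupp, *Combinatorial Group Theory*, Springer (1977); Classics in
  Mathematics (2001), Ch. IV Thm. 2.8. [LyndonSchupp2001]
-/

namespace Literature.GroupTheory.CombinatorialGroupTheory

namespace Amalgam

open Monoid Monoid.PushoutI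

variable {ι : Type*} {G : ι → Type*} [∀ i, Group (G i)] {H : Type*} [Group H]
  {φ : ∀ i, H →* G i}

/-- The value in `PushoutI φ` of a letter list. -/
local notation3 "ℓπ[" φ "] " l:max =>
  List.prod (List.map (fun x => Monoid.PushoutI.of (φ := φ) (Sigma.fst x) (Sigma.snd x)) l)

/-- The formal inverse of a letter list. -/
local notation3 "ℓinv " l:max =>
  List.reverse (List.map (fun x => Sigma.mk (Sigma.fst x) (Sigma.snd x)⁻¹) l)

/-! ### List bookkeeping -/

omit [∀ i, Group (G i)] in
/-- Alternation of `P ++ [a] ++ Q` from its two halves and the junction at `a`.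
[cite: LyndonSchupp2001, Ch. IV §2] -/
theorem isChain_concat_append {P Q : List (Σ i, G i)} {a : Σ i, G i}
    (hP : (P ++ [a]).IsChain fun a b => a.1 ≠ b.1) (hQ : Q.IsChain fun a b => a.1 ≠ b.1)
    (hj : ∀ b ∈ Q.head?, a.1 ≠ b.1) : (P ++ [a] ++ Q).IsChain fun a b => a.1 ≠ b.1 := by
  rw [List.isChain_append]
  refine ⟨hP, hQ, fun x hx y hy => ?_⟩
  rw [List.getLast?_concat, Option.mem_some_iff] at hx
  subst hx
  exact hj y hy

omit [∀ i, Group (G i)] in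
/-- Alternation of `P ++ (a :: Q)` from its two halves and the junction at `a`.
[cite: LyndonSchupp2001, Ch. IV §2] -/
theorem isChain_append_cons {P Q : List (Σ i, G i)} {a : Σ i, G i}
    (hP : P.IsChain fun a b => a.1 ≠ b.1) (hQ : (a :: Q).IsChain fun a b => a.1 ≠ b.1)
    (hj : ∀ b ∈ P.getLast?, b.1 ≠ a.1) : (P ++ a :: Q).IsChain fun a b => a.1 ≠ b.1 := by
  rw [List.isChain_append]
  refine ⟨hP, hQ, fun x hx y hy => ?_⟩
  rw [List.head?_cons, Option.mem_some_iff] at hy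
  subst hy
  exact hj x hx

omit [∀ i, Group (G i)] in
/-- Alternation of `a :: Q` from alternation of `Q` and the junction at `a`.
[cite: LyndonSchupp2001, Ch. IV §2] -/
theorem isChain_cons_of_head {Q : List (Σ i, G i)} {a : Σ i, G i}
    (hQ : Q.IsChain fun a b => a.1 ≠ b.1) (hj : ∀ b ∈ Q.head?, a.1 ≠ b.1) :
    (a :: Q).IsChain fun a b => a.1 ≠ b.1 := by
  cases Q with
  | nil => exact List.IsChain.singleton _
  | cons b Q => exact List.IsChain.cons_cons (hj b rfl) hQ

omit [∀ i, Group (G i)] in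
/-- The junction condition inside an alternating `P ++ [a]`. [cite: LyndonSchupp2001, Ch. IV §2] -/
theorem rel_of_isChain_concat {P : List (Σ i, G i)} {a : Σ i, G i}
    (hP : (P ++ [a]).IsChain fun a b => a.1 ≠ b.1) : ∀ b ∈ P.getLast?, b.1 ≠ a.1 := by
  rw [List.isChain_append] at hP
  exact fun b hb => hP.2.2 b hb a rfl

/-- The first letter of `l⁻¹` is the inverse of the last letter of `l`.
[cite: LyndonSchupp2001, Ch. IV §2] -/
theorem head?_inv (l : List (Σ i, G i)) :
    (ℓinv l).head? = l.getLast?.map fun a => ⟨a.1, a.2⁻¹⟩ := by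
  rw [List.head?_reverse, List.getLast?_map]

/-- The last letter of `l⁻¹` is the inverse of the first letter of `l`.
[cite: LyndonSchupp2001, Ch. IV §2] -/
theorem getLast?_inv (l : List (Σ i, G i)) :
    (ℓinv l).getLast? = l.head?.map fun a => ⟨a.1, a.2⁻¹⟩ := by
  rw [List.getLast?_reverse, List.head?_map]

/-- A word of the shape `P M P⁻¹` with `P` non-empty has both end letters in the factor of the
first letter of `P`. [cite: MagnusKarrassSolitar1966, §4.2 Thm. 4.6] -/
theorem ends_eq_of_conj_shape {P M : List (Σ i, G i)} (hP : P ≠ []) :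
    (P ++ M ++ ℓinv P).head?.map Sigma.fst = (P ++ M ++ ℓinv P).getLast?.map Sigma.fst := by
  have hP' : ℓinv P ≠ [] := by simpa using hP
  rw [List.append_assoc, List.head?_append_of_ne_nil _ hP, ← List.append_assoc,
    List.getLast?_append_of_ne_nil _ hP', getLast?_inv, Option.map_map]
  obtain ⟨a, P', rfl⟩ := List.exists_cons_of_ne_nil hP
  rfl

/-- The value of `P M P⁻¹`. [cite: MagnusKarrassSolitar1966, §4.2 Thm. 4.6] -/
theorem lprod_conj_shape (P M : List (Σ i, G i)) :
    ℓπ[φ] (P ++ M ++ ℓinv P) = ℓπ[φ] P * ℓπ[φ] M * (ℓπ[φ] P)⁻¹ := by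
  rw [lprod_append, lprod_append, lprod_inv]

/-- A word of the shape `P M P⁻¹` with `P` non-empty has length `≥ 2`.
[cite: MagnusKarrassSolitar1966, §4.2 Thm. 4.6] -/
theorem two_le_length_conj_shape {P M : List (Σ i, G i)} (hP : P ≠ []) :
    2 ≤ (P ++ M ++ ℓinv P).length := by
  obtain ⟨a, P', rfl⟩ := List.exists_cons_of_ne_nil hP
  simp only [List.length_append, List.length_cons, List.length_reverse, List.length_map]
  omega

/-! ### Cyclically reduced elements -/

/-- **The value of a reduced word of length `≤ 1`, or with end letters in different factors, is
cyclically reduced**: no reduced word for it of length `≥ 2` has both ends in one factor (pattern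
uniqueness). [cite: LyndonSchupp2001, Ch. IV Thm. 2.8] -/
theorem cr_of_word (hφ : ∀ i, Function.Injective (φ i)) {w : List (Σ i, G i)}
    (hc : w.IsChain fun a b => a.1 ≠ b.1) (hr : ∀ x ∈ w, x.2 ∉ (φ x.1).range)
    (hcr : w.length ≤ 1 ∨ ∀ x ∈ w.getLast?, ∀ y ∈ w.head?, x.1 ≠ y.1) :
    ∀ L : List (Σ i, G i), L.IsChain (fun a b => a.1 ≠ b.1) → (∀ x ∈ L, x.2 ∉ (φ x.1).range) →
      ℓπ[φ] L = ℓπ[φ] w → 2 ≤ L.length → L.head?.map Sigma.fst ≠ L.getLast?.map Sigma.fst := by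
  intro L hLc hLr hval h2 hends
  have hpat := map_fst_eq_of_lprod_eq hφ hLc hLr hc hr 1 (by rw [map_one, one_mul]; exact hval)
  have hlen : L.length = w.length := by simpa using congrArg List.length hpat
  rcases hcr with hcr | hcr
  · have : L.length ≤ 1 := hlen ▸ hcr
    omega
  · have hne : w ≠ [] := by rintro rfl; rw [List.length_nil] at hlen; omega
    have h0 := List.head?_eq_some_head hne
    have h1 := List.getLast?_eq_some_getLast hne
    have hxy := hcr _ h1 _ h0
    rw [← List.head?_map, ← List.getLast?_map, hpat, List.head?_map, List.getLast?_map, h0, h1,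
      Option.map_some, Option.map_some, Option.some_inj] at hends
    exact hxy hends.symm

/-- **Conjugating by a base element preserves cyclic reducedness.**
[cite: LyndonSchupp2001, Ch. IV Thm. 2.8] -/
theorem cr_base_conj {y : PushoutI φ}
    (hy : ∀ L : List (Σ i, G i), L.IsChain (fun a b => a.1 ≠ b.1) →
      (∀ x ∈ L, x.2 ∉ (φ x.1).range) → ℓπ[φ] L = y → 2 ≤ L.length →
      L.head?.map Sigma.fst ≠ L.getLast?.map Sigma.fst) (c : H) :
    ∀ L : List (Σ i, G i), L.IsChain (fun a b => a.1 ≠ b.1) →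
      (∀ x ∈ L, x.2 ∉ (φ x.1).range) → ℓπ[φ] L = base φ c * y * (base φ c)⁻¹ → 2 ≤ L.length →
      L.head?.map Sigma.fst ≠ L.getLast?.map Sigma.fst := by
  intro L hLc hLr hval h2
  -- write `L = a :: L' ++ [b]` and move the base elements into the end letters
  obtain ⟨a, L₁, rfl⟩ := List.exists_cons_of_ne_nil (show L ≠ [] by rintro rfl; simp at h2)
  have hL₁ : L₁ ≠ [] := by rintro rfl; simp at h2
  obtain ⟨L', b, rfl⟩ : ∃ L' b, L₁ = L' ++ [b] :=
    ⟨L₁.dropLast, L₁.getLast hL₁, (List.dropLast_append_getLast hL₁).symm⟩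
  -- the modified word
  have key := hy (⟨a.1, φ a.1 c⁻¹ * a.2⟩ :: (L' ++ [⟨b.1, b.2 * φ b.1 c⟩])) ?_ ?_ ?_ (by simp)
  · have e3 : (a :: (L' ++ [b])).getLast? = some b := by
      rw [← List.cons_append, List.getLast?_concat]
    have e4 : (⟨a.1, φ a.1 c⁻¹ * a.2⟩ :: (L' ++ [⟨b.1, b.2 * φ b.1 c⟩]) : List (Σ i, G i)).getLast? =
        some ⟨b.1, b.2 * φ b.1 c⟩ := by
      rw [← List.cons_append, List.getLast?_concat]
    rw [List.head?_cons, e3]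
    rw [List.head?_cons, e4] at key
    exact key
  · have h1 : (a :: L').IsChain (fun a b => a.1 ≠ b.1) := hLc.infix ⟨[], [b], by simp⟩
    rw [← List.cons_append]
    refine isChain_append_cons (Q := []) ?_ (List.IsChain.singleton _) ?_
    · cases L' with
      | nil => exact List.IsChain.singleton _
      | cons d L'' => exact List.IsChain.cons_cons (h1.rel_head? rfl) h1.tail
    · rw [← List.cons_append] at hLc
      have := rel_of_isChain_concat hLc
      cases L' with
      | nil => simpa using this
      | cons d L'' => simpa using this
  · intro x hx
    rw [List.mem_cons, List.mem_append, List.mem_singleton] at hx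
    rcases hx with rfl | hx | rfl
    · exact base_mul_not_mem_range (hLr a List.mem_cons_self) c⁻¹
    · exact hLr x (List.mem_cons_of_mem _ (List.mem_append_left _ hx))
    · simpa using mul_not_mem_range (hLr b (by simp)) 1 c
  · have e : ℓπ[φ] (⟨a.1, φ a.1 c⁻¹ * a.2⟩ :: (L' ++ [⟨b.1, b.2 * φ b.1 c⟩])) =
        base φ c⁻¹ * ℓπ[φ] (a :: (L' ++ [b])) * base φ c := by
      rw [← List.cons_append, ← lprod_concat_mul_base, List.cons_append, base_mul_lprod_cons]
    rw [e, hval, map_inv]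
    group

/-! ### The three impossible configurations -/

/-- If the last letter of the reduced word `h = hl · x` lies in a factor different from those of
both end letters of the cyclically reduced word `w`, then `h · ℓπ w · h⁻¹` is not cyclically
reduced. [cite: MagnusKarrassSolitar1966, §4.2 Thm. 4.6] -/
theorem not_cr_conj_of_ne_ne {hl w : List (Σ i, G i)} {j : ι} {x : G j} {γ₀ γ : Σ i, G i}
    (hhl : (hl ++ [Sigma.mk j x]).IsChain fun a b => a.1 ≠ b.1)
    (hhr : ∀ y ∈ hl ++ [Sigma.mk j x], y.2 ∉ (φ y.1).range)
    (hwc : w.IsChain fun a b => a.1 ≠ b.1) (hwr : ∀ y ∈ w, y.2 ∉ (φ y.1).range)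
    (hw0 : w.head? = some γ₀) (hw1 : w.getLast? = some γ) (hj0 : j ≠ γ₀.1) (hj1 : j ≠ γ.1) :
    ¬ ∀ L : List (Σ i, G i), L.IsChain (fun a b => a.1 ≠ b.1) →
      (∀ x ∈ L, x.2 ∉ (φ x.1).range) →
      ℓπ[φ] L = ℓπ[φ] (hl ++ [Sigma.mk j x]) * ℓπ[φ] w * (ℓπ[φ] (hl ++ [Sigma.mk j x]))⁻¹ → 2 ≤ L.length →
      L.head?.map Sigma.fst ≠ L.getLast?.map Sigma.fst := by
  intro hY
  refine hY ((hl ++ [Sigma.mk j x]) ++ w ++ ℓinv (hl ++ [Sigma.mk j x])) ?_ ?_ (lprod_conj_shape _ _)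
    (two_le_length_conj_shape (by simp)) (ends_eq_of_conj_shape (by simp))
  · have hw : (w ++ ℓinv (hl ++ [Sigma.mk j x])).IsChain (fun a b => a.1 ≠ b.1) := by
      rw [List.isChain_append, isChain_inv_iff]
      refine ⟨hwc, hhl, fun a ha b hb => ?_⟩
      rw [hw1, Option.mem_some_iff] at ha
      rw [head?_inv, List.getLast?_concat, Option.map_some, Option.mem_some_iff] at hb
      subst ha hb
      exact fun e => hj1 e.symm
    rw [List.append_assoc]
    refine isChain_concat_append hhl hw fun b hb => ?_
    rw [List.head?_append_of_ne_nil _ (by rintro rfl; simp at hw0), hw0, Option.mem_some_iff] at hb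
    subst hb
    exact hj0
  · intro y hy
    rw [List.mem_append, List.mem_append] at hy
    rcases hy with (hy | hy) | hy
    · exact hhr y hy
    · exact hwr y hy
    · exact (offBase_inv_iff _).2 hhr y hy

/-- If the last letter `x` of the reduced word `h = hl · x` lies in the factor of the LAST letter
`γ` of the cyclically reduced word `w = w' γ` but `γ x⁻¹` is not in the base group, then
`h · ℓπ w · h⁻¹` is not cyclically reduced. [cite: MagnusKarrassSolitar1966, §4.2 Thm. 4.6] -/
theorem not_cr_conj_of_last {hl w' : List (Σ i, G i)} {γ₀ γ : Σ i, G i} {x : G γ.1}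
    (hhl : (hl ++ [Sigma.mk γ.1 x]).IsChain fun a b => a.1 ≠ b.1)
    (hhr : ∀ y ∈ hl ++ [Sigma.mk γ.1 x], y.2 ∉ (φ y.1).range)
    (hwc : (w' ++ [γ]).IsChain fun a b => a.1 ≠ b.1) (hwr : ∀ y ∈ w' ++ [γ], y.2 ∉ (φ y.1).range)
    (hw0 : w'.head? = some γ₀) (h01 : γ.1 ≠ γ₀.1) (hx : γ.2 * x⁻¹ ∉ (φ γ.1).range) :
    ¬ ∀ L : List (Σ i, G i), L.IsChain (fun a b => a.1 ≠ b.1) →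
      (∀ x ∈ L, x.2 ∉ (φ x.1).range) →
      ℓπ[φ] L = ℓπ[φ] (hl ++ [Sigma.mk γ.1 x]) * ℓπ[φ] (w' ++ [γ]) * (ℓπ[φ] (hl ++ [Sigma.mk γ.1 x]))⁻¹ →
      2 ≤ L.length → L.head?.map Sigma.fst ≠ L.getLast?.map Sigma.fst := by
  intro hY
  -- the word `hl · (x w' (γ x⁻¹)) · hl⁻¹`
  set M : List (Σ i, G i) := ⟨γ.1, x⟩ :: (w' ++ [⟨γ.1, γ.2 * x⁻¹⟩]) with hM
  have hval : ℓπ[φ] (hl ++ M ++ ℓinv hl) =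
      ℓπ[φ] (hl ++ [Sigma.mk γ.1 x]) * ℓπ[φ] (w' ++ [γ]) * (ℓπ[φ] (hl ++ [Sigma.mk γ.1 x]))⁻¹ := by
    rw [lprod_conj_shape, hM]
    simp only [lprod_append, lprod_cons, lprod_nil, map_mul, map_inv, mul_inv_rev, mul_assoc, mul_one]
  have hMc : M.IsChain (fun a b => a.1 ≠ b.1) := by
    rw [hM, ← List.cons_append]
    refine isChain_append_cons (Q := []) ?_ (List.IsChain.singleton _) ?_
    · refine isChain_cons_of_head (hwc.infix ⟨[], [γ], by simp⟩) fun b hb => ?_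
      rw [hw0, Option.mem_some_iff] at hb; subst hb; exact h01
    · intro b hb
      have hw'ne : w' ≠ [] := by rintro rfl; simp at hw0
      rw [List.getLast?_cons, (List.getLast?_eq_some_getLast hw'ne), Option.getD_some, Option.mem_some_iff]
        at hb
      subst hb
      exact rel_of_isChain_concat hwc _ (List.getLast?_eq_some_getLast hw'ne)
  have hMr : ∀ y ∈ M, y.2 ∉ (φ y.1).range := by
    intro y hy
    rw [hM, List.mem_cons, List.mem_append, List.mem_singleton] at hy
    rcases hy with rfl | hy | rfl
    · exact hhr _ (by simp)
    · exact hwr y (List.mem_append_left _ hy)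
    · exact hx
  rcases List.eq_nil_or_concat hl |>.imp_right (fun ⟨P, a, h⟩ => (⟨P, a, by
      rw [h, List.concat_eq_append]⟩ : ∃ P a, hl = P ++ [a])) with rfl | ⟨hl', a, rfl⟩
  · -- `h = x`: the word is `M` itself
    refine hY M hMc hMr (by simpa using hval) (by simp [hM]) ?_
    rw [hM, List.head?_cons, ← List.cons_append, List.getLast?_concat]
    rfl
  · refine hY (hl' ++ [a] ++ M ++ ℓinv (hl' ++ [a])) ?_ ?_ hval (two_le_length_conj_shape (by simp))
      (ends_eq_of_conj_shape (by simp))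
    · have h2 : (M ++ ℓinv (hl' ++ [a])).IsChain (fun a b => a.1 ≠ b.1) := by
        rw [hM, ← List.cons_append, List.append_assoc, List.singleton_append]
        refine isChain_append_cons (hMc.infix ⟨[], [⟨γ.1, γ.2 * x⁻¹⟩], by simp [hM]⟩) ?_ ?_
        · refine isChain_cons_of_head ((isChain_inv_iff _).2 (hhl.infix ⟨[], [⟨γ.1, x⟩], by simp⟩))
            fun b hb => ?_
          rw [head?_inv, List.getLast?_concat, Option.map_some, Option.mem_some_iff] at hb
          subst hb
          exact fun e => rel_of_isChain_concat hhl a (by simp) e.symm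
        · have hMc' := hMc
          rw [hM, ← List.cons_append] at hMc'
          exact rel_of_isChain_concat hMc'
      rw [List.append_assoc (hl' ++ [a])]
      exact isChain_concat_append (hhl.infix ⟨[], [⟨γ.1, x⟩], by simp⟩) h2 fun b hb => by
        rw [List.head?_append_of_ne_nil _ (by simp [hM]), hM, List.head?_cons, Option.mem_some_iff]
          at hb
        subst hb
        exact rel_of_isChain_concat hhl a (by simp)
    · intro y hy
      rw [List.mem_append, List.mem_append] at hy
      rcases hy with (hy | hy) | hy
      · exact hhr y (List.mem_append_left _ hy)
      · exact hMr y hy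
      · exact (offBase_inv_iff _).2 (fun z hz => hhr z (List.mem_append_left _ hz)) y hy

/-- If the last letter `x` of the reduced word `h = hl · x` lies in the factor of the FIRST letter
`γ₀` of the cyclically reduced word `w = γ₀ w'` but `x γ₀` is not in the base group, then
`h · ℓπ w · h⁻¹` is not cyclically reduced. [cite: MagnusKarrassSolitar1966, §4.2 Thm. 4.6] -/
theorem not_cr_conj_of_head {hl w' : List (Σ i, G i)} {γ₀ γ : Σ i, G i} {x : G γ₀.1}
    (hhl : (hl ++ [Sigma.mk γ₀.1 x]).IsChain fun a b => a.1 ≠ b.1)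
    (hhr : ∀ y ∈ hl ++ [Sigma.mk γ₀.1 x], y.2 ∉ (φ y.1).range)
    (hwc : (γ₀ :: w').IsChain fun a b => a.1 ≠ b.1) (hwr : ∀ y ∈ γ₀ :: w', y.2 ∉ (φ y.1).range)
    (hw1 : w'.getLast? = some γ) (h01 : γ.1 ≠ γ₀.1) (hx : x * γ₀.2 ∉ (φ γ₀.1).range) :
    ¬ ∀ L : List (Σ i, G i), L.IsChain (fun a b => a.1 ≠ b.1) →
      (∀ x ∈ L, x.2 ∉ (φ x.1).range) →
      ℓπ[φ] L = ℓπ[φ] (hl ++ [Sigma.mk γ₀.1 x]) * ℓπ[φ] (γ₀ :: w') * (ℓπ[φ] (hl ++ [Sigma.mk γ₀.1 x]))⁻¹ →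
      2 ≤ L.length → L.head?.map Sigma.fst ≠ L.getLast?.map Sigma.fst := by
  intro hY
  -- the word `hl · ((x γ₀) w' x⁻¹) · hl⁻¹`
  set M : List (Σ i, G i) := ⟨γ₀.1, x * γ₀.2⟩ :: (w' ++ [⟨γ₀.1, x⁻¹⟩]) with hM
  have hval : ℓπ[φ] (hl ++ M ++ ℓinv hl) =
      ℓπ[φ] (hl ++ [Sigma.mk γ₀.1 x]) * ℓπ[φ] (γ₀ :: w') * (ℓπ[φ] (hl ++ [Sigma.mk γ₀.1 x]))⁻¹ := by
    rw [lprod_conj_shape, hM]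
    simp only [lprod_append, lprod_cons, lprod_nil, map_mul, map_inv, mul_inv_rev, mul_assoc, mul_one]
  have hw'ne : w' ≠ [] := by rintro rfl; simp at hw1
  have hMc : M.IsChain (fun a b => a.1 ≠ b.1) := by
    rw [hM, ← List.cons_append]
    refine isChain_append_cons (Q := []) ?_ (List.IsChain.singleton _) ?_
    · exact isChain_cons_of_head hwc.tail fun b hb => hwc.rel_head? hb
    · intro b hb
      rw [List.getLast?_cons, List.getLast?_eq_some_getLast hw'ne, Option.getD_some, Option.mem_some_iff]
        at hb
      rw [List.getLast?_eq_some_getLast hw'ne, Option.some_inj] at hw1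
      rw [← hb, hw1]
      exact h01
  have hMr : ∀ y ∈ M, y.2 ∉ (φ y.1).range := by
    intro y hy
    rw [hM, List.mem_cons, List.mem_append, List.mem_singleton] at hy
    rcases hy with rfl | hy | rfl
    · exact hx
    · exact hwr y (List.mem_cons_of_mem _ hy)
    · exact inv_not_mem_range (hhr ⟨γ₀.1, x⟩ (by simp))
  rcases List.eq_nil_or_concat hl |>.imp_right (fun ⟨P, a, h⟩ => (⟨P, a, by
      rw [h, List.concat_eq_append]⟩ : ∃ P a, hl = P ++ [a])) with rfl | ⟨hl', a, rfl⟩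
  · refine hY M hMc hMr (by simpa using hval) (by simp [hM]) ?_
    rw [hM, List.head?_cons, ← List.cons_append, List.getLast?_concat]
    rfl
  · refine hY (hl' ++ [a] ++ M ++ ℓinv (hl' ++ [a])) ?_ ?_ hval (two_le_length_conj_shape (by simp))
      (ends_eq_of_conj_shape (by simp))
    · have h2 : (M ++ ℓinv (hl' ++ [a])).IsChain (fun a b => a.1 ≠ b.1) := by
        rw [hM, ← List.cons_append, List.append_assoc, List.singleton_append]
        refine isChain_append_cons (hMc.infix ⟨[], [⟨γ₀.1, x⁻¹⟩], by simp [hM]⟩) ?_ ?_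
        · refine isChain_cons_of_head ((isChain_inv_iff _).2 (hhl.infix ⟨[], [⟨γ₀.1, x⟩], by simp⟩))
            fun b hb => ?_
          rw [head?_inv, List.getLast?_concat, Option.map_some, Option.mem_some_iff] at hb
          subst hb
          exact fun e => rel_of_isChain_concat hhl a (by simp) e.symm
        · have hMc' := hMc
          rw [hM, ← List.cons_append] at hMc'
          exact rel_of_isChain_concat hMc'
      rw [List.append_assoc (hl' ++ [a])]
      exact isChain_concat_append (hhl.infix ⟨[], [⟨γ₀.1, x⟩], by simp⟩) h2 fun b hb => by
        rw [List.head?_append_of_ne_nil _ (by simp [hM]), hM, List.head?_cons, Option.mem_some_iff]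
          at hb
        subst hb
        exact rel_of_isChain_concat hhl a (by simp)
    · intro y hy
      rw [List.mem_append, List.mem_append] at hy
      rcases hy with (hy | hy) | hy
      · exact hhr y (List.mem_append_left _ hy)
      · exact hMr y hy
      · exact (offBase_inv_iff _).2 (fun z hz => hhr z (List.mem_append_left _ hz)) y hy

end Amalgam

end Literature.GroupTheory.CombinatorialGroupTheory
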